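import Summits.CriticalPhenomena.CardyFormulaZ2.Theorems.CardyFlipRussoVoronoiHubFromSmirnovChainArmCut

/-!
# Stub `chainArm_localize` of line `moebius-exact-delaunay-dilation-ward`
# (crux `VoronoiHubFromSmirnov`, stmt-CriticalPhenomena-6433, route `CardyFlipRusso`)

**Localising a chain arm to a band around the annulus** (re-planned S3b-i, one-arm route;
Benjamini–Schramm, *Conformal invariance of Voronoi percolation*, Comm. Math. Phys. 197 (1998),
§4 and §9 (9.1)).

A chain arm for the adjacency `E` around `z` from radius `r₀` out to radius `r₂` contains, for every
sub-annulus `[r₁, r₂']` with `r₀ ≤ r₁ < r₂' ≤ r₂`, a chain arm for `E` across `[r₁, r₂']` all of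
whose points lie in the band `{x | r₁ - L ≤ dist x z ≤ r₂' + L}`, `L` being a bound on the length of
the `E`-steps between points of `b` physically in `K`.  Proof: read the chain on `ℕ`
(`natChain_of_chainArm`) and cut it (`exists_cut_indices`) at the LAST index `a` within distance
`r₁` of `z` before the FIRST index `c` at distance `≥ r₂'`; then `a < c`, every index in `(a, c]` is
at distance `> r₁` and every index in `[a, c)` at distance `< r₂'`, so by the step bound and the
triangle inequality every point of the piece `a, …, c` is at distance in `[r₁ - L, r₂' + L]`
(the first point through its successor, the last point through its predecessor).  Pure
combinatorics; no new definitions.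
-/

noncomputable section

namespace Summit.CriticalPhenomena.CardyFormulaZ2.Cruxes.VoronoiHubFromSmirnov.MoebiusExactDelaunayDilationWard

/-- Segment form of `chainArm_of_natChain`: a segment `a ≤ n ≤ c` of an `ℕ`-indexed sequence whose
points ON THE SEGMENT belong to `b` and are physically in `K`, starting within `r₁` of `z`, ending at
distance `≥ r₂`, with `E`-adjacent consecutive points, is a chain arm for `E`. -/
theorem chainArm_of_natChain_seg {E : ℂ → ℂ → Prop} {z : ℂ} {r₁ r₂ : ℝ} {K : Set ℂ} {δ : ℝ}
    {b : Set ℂ} (f : ℕ → ℂ) {a c : ℕ} (hac : a ≤ c) (hb : ∀ n, a ≤ n → n ≤ c → f n ∈ b)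
    (hK : ∀ n, a ≤ n → n ≤ c → (δ : ℂ) * f n ∈ K) (ha : dist (f a) z ≤ r₁)
    (hc : r₂ ≤ dist (f c) z) (hE : ∀ n, a ≤ n → n < c → E (f n) (f (n + 1))) :
    ChainArm E z r₁ r₂ K δ b := by
  refine ⟨c - a, fun k => f (a + k),
    fun k => hb _ (Nat.le_add_right a k) (by have := k.isLt; omega),
    fun k => hK _ (Nat.le_add_right a k) (by have := k.isLt; omega), ?_, ?_, ?_⟩
  · dsimp only
    rw [Fin.val_zero, add_zero]
    exact ha
  · dsimp only
    rw [Fin.val_last, Nat.add_sub_cancel' hac]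
    exact hc
  · intro i
    have h := hE (a + i) (Nat.le_add_right a i) (by have := i.isLt; omega)
    dsimp only
    rw [Fin.val_castSucc, Fin.val_succ, ← add_assoc]
    exact h

/-- **S3b-i, localisation of a chain arm.** A chain arm for `E` around `z` from radius `r₀` out to
`r₂` contains, across any sub-annulus `[r₁, r₂']` with `r₀ ≤ r₁ < r₂' ≤ r₂`, a chain arm for `E`
whose points all lie in the band `{x | r₁ - L ≤ dist x z ∧ dist x z ≤ r₂' + L}`, provided `E`-steps
between points of `b` physically in `K` have length `≤ L`: cut the chain at the last index within
`r₁` of `z` before the first index at distance `≥ r₂'`; on the piece in between every point but the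
first is at distance `> r₁` and every point but the last at distance `< r₂'`, and the two endpoints
are within `L` of their neighbours on the piece.
(source: BenjaminiSchramm1998 §4, §9 (9.1), square-by-square telescoping form) -/
theorem chainArm_localize : ∀ (E : ℂ → ℂ → Prop) (z : ℂ) (r₀ r₁ r₂' r₂ L : ℝ) (K : Set ℂ) (δ : ℝ)
    (b : Set ℂ), 0 ≤ L → ChainArm E z r₀ r₂ K δ b → r₀ ≤ r₁ → r₁ < r₂' → r₂' ≤ r₂ →
    (∀ p q : ℂ, p ∈ b → q ∈ b → (δ : ℂ) * p ∈ K → (δ : ℂ) * q ∈ K → E p q → dist p q ≤ L) →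
    ChainArm E z r₁ r₂' K δ (b ∩ {x : ℂ | r₁ - L ≤ dist x z ∧ dist x z ≤ r₂' + L}) := by
  intro E z r₀ r₁ r₂' r₂ L K δ b hL hArm h01 h12 h22 hStep
  obtain ⟨N, f, hb, hK, h0, hN, hE⟩ := natChain_of_chainArm hArm
  obtain ⟨a, c, hac, hcN, haA, hcB, hA, hB⟩ :=
    exists_cut_indices (fun n => dist (f n) z ≤ r₁) (fun n => r₂' ≤ dist (f n) z) N
      (h0.trans h01) (h22.trans hN) (fun n hn hn' => absurd (hn'.trans hn) (not_le.mpr h12))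
  have haA' : dist (f a) z ≤ r₁ := haA
  -- the steps `f n → f (n + 1)`, `n < c`, are `E`-adjacent, hence short
  have hstep : ∀ n, n < c → dist (f n) (f (n + 1)) ≤ L := fun n hnc =>
    hStep _ _ (hb _) (hb _) (hK _) (hK _) (hE n (lt_of_lt_of_le hnc hcN))
  -- every point of the piece `a, …, c` lies in the band
  have hband : ∀ m, a ≤ m → m ≤ c → r₁ - L ≤ dist (f m) z ∧ dist (f m) z ≤ r₂' + L := by
    intro m ham hmc
    rcases ham.eq_or_lt with hma | ham'
    · -- the first point: within `r₁ ≤ r₂'` of `z`, and within `L` of its successor, at `> r₁`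
      rw [← hma]
      have h1 : r₁ < dist (f (a + 1)) z :=
        not_le.mp (hA (a + 1) (Nat.lt_add_one a) (Nat.succ_le_of_lt hac))
      have ht := dist_triangle (f (a + 1)) (f a) z
      rw [dist_comm (f (a + 1)) (f a)] at ht
      have hs := hstep a hac
      constructor <;> linarith
    · -- a later point `m' + 1`: at `> r₁`, and within `L` of its predecessor, at `< r₂'`
      obtain ⟨m', rfl⟩ : ∃ m', m = m' + 1 := ⟨m - 1, by omega⟩
      have hm'c : m' < c := Nat.lt_of_succ_le hmc
      have h1 : r₁ < dist (f (m' + 1)) z := not_le.mp (hA (m' + 1) ham' hmc)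
      have h2 : dist (f m') z < r₂' := not_le.mp (hB m' hm'c)
      have ht := dist_triangle (f (m' + 1)) (f m') z
      rw [dist_comm (f (m' + 1)) (f m')] at ht
      have hs := hstep m' hm'c
      constructor <;> linarith
  exact chainArm_of_natChain_seg f hac.le (fun n han hnc => ⟨hb n, hband n han hnc⟩)
    (fun n _ _ => hK n) haA' hcB fun n _ hnc => hE n (lt_of_lt_of_le hnc hcN)

end Summit.CriticalPhenomena.CardyFormulaZ2.Cruxes.VoronoiHubFromSmirnov.MoebiusExactDelaunayDilationWard

end
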